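import Literature.Analysis.FluidPDE.NSLerayBlowupRateTopHolds
import Literature.Analysis.FluidPDE.NSLerayBlowupRateHolds
import Summits.NavierStokesRegularity.NavierStokesRegularity.Theorems.CertifiedBlowupCertifiedBlowupAxisymBlowupSwirlPersists
import HarnessLib

/-!
# Leray's lower blow-up rates for every witness of the crux `CertifiedBlowupAxisymBlowup`

Theorems file landed `--supports stmt-NavierStokesRegularity-0727`, line `compact-amplification`
(continuation lead c3, wave 1). A witness of the crux is a viscosity `ν > 0`, a time `T > 0` and a
maximal smooth solution `(u, p)` of the unforced Navier–Stokes system of lifespan `T`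
(`IsMaximalSmoothSolution ν 0 u p T`), Leray–Hopf on `[0, T]` from its rapidly decaying axisymmetric
datum `u 0`. Leray 1934, §19 (3.8)–(3.9) and §22 ("un premier caractère des irrégularités"): a
solution which becomes irregular at the time `T` blows up no slower than the self-similar rate,
`max |u(t)| > A √(ν/(T - t))` and `‖u(t)‖_{L^r} > A(1 - 3/r) ν^{(r+3)/(2r)} (T - t)^{-(r-3)/(2r)}`
(`r > 3`). Both rates are THEOREMS of the tree for maximal Leray–Hopf classical solutions which are
essentially bounded on the earlier closed slabs `[0, T'] × ℝ³`, `T' < T`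
(`leray_blowup_rate_top_holds`, `leray_blowup_rate_holds`, discharging ns.S28). This file records
them at the crux, kernel-checked and unconditional:

* `eLpNorm_uncurry_lt_top_of_lerayHopf_classical`: the boundedness hypothesis of ns.S28 holds for
  the crux's class — a classical Leray–Hopf solution on `[0, T)` from a rapidly decaying
  axisymmetric datum is essentially bounded on `[0, T'] × ℝ³` for every `0 < T' < T` (the pointwise
  bound `bounded_before_of_lerayHopf_classical`, made essential);
* `leray_rates_of_isMaximalSmoothSolution` (registered stub): there is an absolute `c > 0` with
  `‖u(t)‖_{L^∞} ≥ c √ν / √(T - t)` AND a point `x` with `|u(t, x)| ≥ c √ν / √(T - t)` for every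
  witness and every `t ∈ [0, T)` (take half of Leray's constant: were all values below it, the
  essential supremum would be at most half the rate), and for every `3 < r < ∞` a constant `c_r > 0`
  with `‖u(t)‖_{L^r} ≥ c_r ν^{(r+3)/(2r)} (T - t)^{-(r-3)/(2r)}`.

Together with the landed Type II necessity `not_isTypeIBlowup_of_isMaximalSmoothSolution` this is
the two-sided squeeze at the crux: from below `≥ c √ν/√(T - t)` at some point of every slice, while
NO bound `≤ C/√(T - t)` holds near `T`.

No new definitions, no named-fact hypotheses, no `sorry`.

## References

* J. Leray, *Sur le mouvement d'un liquide visqueux emplissant l'espace*, Acta Math. 63 (1934),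
  193–248: §19 (3.8)–(3.9) p. 224, §22 p. 227. [Leray1934]
* W. S. Ożański, B. C. Pooley, *Leray's fundamental work on the Navier–Stokes equations: a modern
  review of "Sur le mouvement d'un liquide visqueux emplissant l'espace"*, in: Partial
  Differential Equations in Fluid Mechanics, LMS Lecture Note Ser. 452, CUP 2018, pp. 113–203,
  Cor. 6.25. [OzanskiPooley2018]
* Y. Giga, *Solutions for semilinear parabolic equations in `L^p` and regularity of weak solutions
  of the Navier–Stokes system*, J. Differential Equations 62 (1986), 186–212, Thm. 4. [Giga1986]
-/

-- the summit and its single problem share the name (D-0017 nested layout)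
set_option linter.dupNamespace false

noncomputable section

open MeasureTheory Set Function Filter Topology Metric
open scoped ENNReal NNReal

namespace Summit.NavierStokesRegularity.NavierStokesRegularity.Theorems.CertifiedBlowupAxisymBlowup.CompactAmplification

open Literature.Analysis.FluidPDE

section Witness

variable {ν T : ℝ} {u : ℝ → (EuclideanSpace ℝ (Fin 3)) → (EuclideanSpace ℝ (Fin 3))} {p : ℝ → (EuclideanSpace ℝ (Fin 3)) → ℝ}

/-- **Essential boundedness on every earlier closed slab** `[0, T'] × ℝ³`, `0 < T' < T`, of a
classical Leray–Hopf solution on `[0, T)` from a rapidly decaying axisymmetric datum: the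
boundedness hypothesis of ns.S28 (`leray_blowup_rate_top`, `leray_blowup_rate`) and of Seregin's
`L³` criterion, obtained from the pointwise bound `bounded_before_of_lerayHopf_classical`.
[folklore] -/
theorem eLpNorm_uncurry_lt_top_of_lerayHopf_classical (hν : 0 < ν)
    (hcl : IsClassicalNSSolutionOn (Ico 0 T) ν 0 u p) (hLH : IsLerayHopfOn T ν 0 (u 0) u)
    (hdec : HasRapidSpatialDecay (u 0)) (haxi : IsAxisymmetric (u 0)) :
    ∀ T' ∈ Ioo 0 T, eLpNorm (uncurry u) ∞ (volume.restrict (Icc 0 T' ×ˢ univ)) < ∞ := by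
  intro T' hT'
  obtain ⟨M, hM⟩ := bounded_before_of_lerayHopf_classical hν hcl hLH hdec haxi T' hT'.2
  exact eLpNorm_uncurry_restrict_lt_top_of_bound hM le_rfl

end Witness

/-- **Leray's lower blow-up rates for every witness of the crux** (registered stub of
stmt-NavierStokesRegularity-0727; Leray 1934 §19 (3.9) and §22 = the tree theorems
`leray_blowup_rate_top_holds`, `leray_blowup_rate_holds` at the crux). (i) There is an absolute
`c > 0` such that for every maximal Leray–Hopf classical solution `(u, p)` of viscosity `ν > 0` and
finite lifespan `T` from a rapidly decaying axisymmetric datum and every `t ∈ [0, T)`,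
`‖u(t)‖_{L^∞} ≥ c √ν / √(T - t)` and some point `x` has `|u(t, x)| ≥ c √ν / √(T - t)` (with `c`
half of Leray's constant `c₀`: if every value were `< c₀/2 · √ν/√(T - t)`, the essential supremum
would be `≤ c₀/2 · √ν/√(T - t) < c₀ · √ν/√(T - t)`). (ii) For every `3 < r < ∞` there is `c_r > 0`
with `‖u(t)‖_{L^r} ≥ c_r ν^{(r+3)/(2r)} (T - t)^{-(r-3)/(2r)}` for all such `(u, p)` and
`t ∈ [0, T)`. The sub-slab boundedness required by the tree facts is
`eLpNorm_uncurry_lt_top_of_lerayHopf_classical`.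
[cite: Leray1934, §19 (3.8)–(3.9) p. 224 and §22 p. 227] [cite: OzanskiPooley2018, Cor. 6.25]
[cite: Giga1986, Thm. 4] -/
theorem leray_rates_of_isMaximalSmoothSolution :
    (∃ c : ℝ, 0 < c ∧ ∀ {ν T : ℝ} {u : ℝ → EuclideanSpace ℝ (Fin 3) → EuclideanSpace ℝ (Fin 3)}
      {p : ℝ → EuclideanSpace ℝ (Fin 3) → ℝ}, 0 < ν → 0 < T → IsMaximalSmoothSolution ν 0 u p T →
      IsLerayHopfOn T ν 0 (u 0) u → HasRapidSpatialDecay (u 0) → IsAxisymmetric (u 0) →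
      ∀ t ∈ Set.Ico 0 T, ENNReal.ofReal (c * Real.sqrt ν / Real.sqrt (T - t)) ≤
        eLpNorm (u t) ⊤ volume ∧ ∃ x, c * Real.sqrt ν / Real.sqrt (T - t) ≤ ‖u t x‖) ∧
    (∀ r : ℝ, 3 < r → ∃ c : ℝ, 0 < c ∧ ∀ {ν T : ℝ}
      {u : ℝ → EuclideanSpace ℝ (Fin 3) → EuclideanSpace ℝ (Fin 3)}
      {p : ℝ → EuclideanSpace ℝ (Fin 3) → ℝ}, 0 < ν → 0 < T → IsMaximalSmoothSolution ν 0 u p T →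
      IsLerayHopfOn T ν 0 (u 0) u → HasRapidSpatialDecay (u 0) → IsAxisymmetric (u 0) →
      ∀ t ∈ Set.Ico 0 T,
        ENNReal.ofReal (c * ν ^ ((r + 3) / (2 * r)) * (T - t) ^ (-((r - 3) / (2 * r)))) ≤
          eLpNorm (u t) (ENNReal.ofReal r) volume) := by
  refine ⟨?_, fun r hr => ?_⟩
  · obtain ⟨c₀, hc₀, h⟩ := leray_blowup_rate_top_holds
    refine ⟨c₀ / 2, half_pos hc₀, fun {ν T u p} hν hT hmax hLH hdec haxi t ht => ?_⟩
    have hrate := h ν T hν hT u p hmax hLH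
      (eLpNorm_uncurry_lt_top_of_lerayHopf_classical hν hmax.1 hLH hdec haxi) t ht
    have hs : 0 < Real.sqrt ν / Real.sqrt (T - t) :=
      div_pos (Real.sqrt_pos.2 hν) (Real.sqrt_pos.2 (sub_pos.2 ht.2))
    have hle : c₀ / 2 * Real.sqrt ν / Real.sqrt (T - t) ≤ c₀ * Real.sqrt ν / Real.sqrt (T - t) := by
      rw [mul_div_assoc, mul_div_assoc]
      exact mul_le_mul_of_nonneg_right (half_le_self hc₀.le) hs.le
    refine ⟨(ENNReal.ofReal_le_ofReal hle).trans hrate, ?_⟩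
    by_contra hx
    push Not at hx
    have hbound : eLpNorm (u t) ⊤ volume ≤
        ENNReal.ofReal (c₀ / 2 * Real.sqrt ν / Real.sqrt (T - t)) := by
      rw [eLpNorm_exponent_top]
      exact eLpNormEssSup_le_of_ae_bound (ae_of_all _ fun x => (hx x).le)
    have hpos : 0 < c₀ / 2 * Real.sqrt ν / Real.sqrt (T - t) := by
      rw [mul_div_assoc]; exact mul_pos (half_pos hc₀) hs
    have hcmp := (ENNReal.ofReal_le_ofReal_iff hpos.le).1 (hrate.trans hbound)
    rw [mul_div_assoc, mul_div_assoc] at hcmp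
    nlinarith [mul_pos hc₀ hs]
  · obtain ⟨c, hc, h⟩ := leray_blowup_rate_holds r hr
    exact ⟨c, hc, fun {ν T u p} hν hT hmax hLH hdec haxi t ht =>
      h ν T hν hT u p hmax hLH (eLpNorm_uncurry_lt_top_of_lerayHopf_classical hν hmax.1 hLH hdec haxi)
        t ht⟩

end Summit.NavierStokesRegularity.NavierStokesRegularity.Theorems.CertifiedBlowupAxisymBlowup.CompactAmplification

end
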